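import Mathlib.AlgebraicGeometry.Fiber
import Literature.AlgebraicGeometry.Dimension.SmoothRelativeDimensionBound
import Literature.AlgebraicGeometry.Motives.GrothendieckVanishingProofs
import HarnessLib

/-!
# Fibres of a morphism smooth of relative dimension `n` have dimension `≤ n`; `sdim` of a subspace

Topic: `Literature/AlgebraicGeometry/Dimension`. Two pieces of dimension bookkeeping feeding
Grothendieck vanishing WITH SUPPORTS
(`Literature.AlgebraicGeometry.Motives.GrothendieckVanishingProof.vanishingOn`: an abelian sheaf on a
noetherian space supported on a closed subset `Y` has `Hⁱ = 0` for `i > sdim Y`, where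
`Motives.sdim Y` is the supremum of the lengths of chains of irreducible closed subsets of the
AMBIENT space contained in `Y`):

* `sdim_le_topologicalKrullDim_subtype` — for any subset `Y ⊆ X`, `sdim Y ≤ dim Y` (the Krull
  dimension of the subspace `Y`): an irreducible closed `Z ⊆ Y` of `X` traces an irreducible closed
  subset `Z ∩ Y = Z` of the subspace, injectively and monotonically;
  with equality for `Y` closed (`sdim_eq_topologicalKrullDim_of_isClosed`: conversely an irreducible
  closed subset of the closed subspace `Y` is irreducible and closed in `X`), the comparison left
  unproved in `Motives/GrothendieckVanishingProofs` (docstring of `sdim`; Hartshorne I.1, p. 5, and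
  I Ex. 1.10);
* `topologicalKrullDim_fiber_le_of_smoothOfRelativeDimension` — **the scheme-theoretic fibres
  `f⁻¹(y) = X ×_Y Spec κ(y)` of a morphism `f : X → Y` smooth of relative dimension `n` (Mathlib
  `SmoothOfRelativeDimension`, `Scheme.Hom.fiber`) have dimension `≤ n`**: the fibre is smooth of
  relative dimension `n` over the field `κ(y)` (base change), so
  `Dimension.topologicalKrullDim_le_of_smoothOfRelativeDimension` applies with `dim κ(y) = 0`;
  hence (`topologicalKrullDim_preimage_singleton_le`, through Mathlib's homeomorphism
  `Scheme.Hom.fiberHomeo : f.fiber y ≃ₜ f ⁻¹' {y}`) the subspace `f ⁻¹ {y} ⊆ X` has dimension `≤ n`,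
  and (`sdim_preimage_singleton_le`) `sdim (f ⁻¹ {y}) ≤ n`; with EQUALITY over the points of the
  image (`topologicalKrullDim_fiber_eq_of_smoothOfRelativeDimension`,
  `topologicalKrullDim_preimage_singleton_eq`, `sdim_preimage_singleton_eq` for closed points),
  from the field-case equality `Motives.topologicalKrullDim_eq_of_smoothOfRelativeDimension`.

Used for the special fibre `V(p) = f⁻¹(𝔪)` of a smooth `p`-adic scheme `𝒳 → Spec W(k)` of relative
dimension `d` (`KTheory/HuComplexSupportedVanishing`: `sdim V(p) ≤ d`, whence the hypercohomology of
X. Hu's complexes `p^{r,M}_{r,N}Ω•`, supported on `V(p)`, vanishes above `(r − 1) + d`).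

## References

* R. Hartshorne, *Algebraic Geometry* (1977), I.1 (p. 5) and I Ex. 1.10 (dimension of subspaces),
  III.9.5–9.6 / III.10 (dimension of fibres, relative dimension). [Hartshorne1977]
* U. Görtz, T. Wedhorn, *Algebraic Geometry I*, 2nd ed. (2020), Lemma 6.26 (field case).
  [GortzWedhorn2020]
-/

universe u

open TopologicalSpace Order

namespace Literature.AlgebraicGeometry.Dimension

/-! ### `sdim` of a subset versus the Krull dimension of the subspace -/

section Subspace

variable {X : Type u} [TopologicalSpace X]

/-- **`sdim Y ≤ dim Y`**: the dimension of a subset `Y ⊆ X` measured by chains of irreducible closed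
subsets of `X` inside `Y` (`Motives.sdim`) is at most the Krull dimension of the subspace `Y`
(Hartshorne I.1 / I Ex. 1.10): an irreducible closed `Z ⊆ Y` of `X` traces the irreducible closed
subset `{y ∈ Y | y ∈ Z}` of the subspace (the image of the irreducible space `Z` under the
continuous inclusion `Z ↪ Y`), injectively and monotonically in `Z`. [cite: Hartshorne1977, I Ex. 1.10] -/
theorem sdim_le_topologicalKrullDim_subtype (Y : Set X) :
    Literature.AlgebraicGeometry.Motives.sdim Y ≤ topologicalKrullDim Y := by
  -- the trace of an irreducible closed `Z ⊆ Y` on the subspace `Y`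
  have irred : ∀ Z : {Z : IrreducibleCloseds X // (Z : Set X) ⊆ Y},
      IsIrreducible {y : Y | (y : X) ∈ (Z.1 : Set X)} := fun Z => by
    haveI := Subtype.irreducibleSpace Z.1.isIrreducible
    have h := (IrreducibleSpace.isIrreducible_univ (↥(Z.1 : Set X))).image (Set.inclusion Z.2)
      (continuous_inclusion Z.2).continuousOn
    rwa [Set.image_univ, Set.range_inclusion] at h
  let ρ : {Z : IrreducibleCloseds X // (Z : Set X) ⊆ Y} → IrreducibleCloseds Y := fun Z =>
    { carrier := {y : Y | (y : X) ∈ (Z.1 : Set X)}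
      isIrreducible' := irred Z
      isClosed' := Z.1.isClosed.preimage continuous_subtype_val }
  have hmem : ∀ (Z : {Z : IrreducibleCloseds X // (Z : Set X) ⊆ Y}) (y : Y),
      y ∈ ρ Z ↔ (y : X) ∈ (Z.1 : Set X) := fun _ _ => Iff.rfl
  refine krullDim_le_of_strictMono ρ (Monotone.strictMono_of_injective
    (fun Z Z' h y hy => (hmem Z' y).mpr (h ((hmem Z y).mp hy))) fun Z Z' h => ?_)
  refine Subtype.ext (IrreducibleCloseds.ext (Set.ext fun x => ⟨fun hx => ?_, fun hx => ?_⟩))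
  · have hm : (⟨x, Z.2 hx⟩ : Y) ∈ ρ Z := hx
    rw [h] at hm
    exact hm
  · have hm : (⟨x, Z'.2 hx⟩ : Y) ∈ ρ Z' := hx
    rw [← h] at hm
    exact hm

/-- For a CLOSED subset `Y`, conversely `dim Y ≤ sdim Y`: an irreducible closed subset of the
subspace `Y` is (the trace of) an irreducible closed subset of `X` contained in `Y` (Mathlib
`IrreducibleCloseds.map` along the closed embedding `Y ↪ X`). [cite: Hartshorne1977, I Ex. 1.10] -/
theorem topologicalKrullDim_subtype_le_sdim {Y : Set X} (hY : IsClosed Y) :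
    topologicalKrullDim Y ≤ Literature.AlgebraicGeometry.Motives.sdim Y := by
  refine krullDim_le_of_strictMono
    (fun T : IrreducibleCloseds Y =>
      (⟨IrreducibleCloseds.map Subtype.val continuous_subtype_val T,
        closure_minimal (Subtype.coe_image_subset Y T) hY⟩ :
        {Z : IrreducibleCloseds X // (Z : Set X) ⊆ Y})) fun a b hab => ?_
  exact IrreducibleCloseds.map_strictMono_of_isInducing Topology.IsInducing.subtypeVal hab

/-- **`sdim Y = dim Y` for `Y` closed**: the dimension of a closed subset measured inside the
ambient space is the Krull dimension of the subspace (Hartshorne I.1, p. 5, and I Ex. 1.10; the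
comparison left open in the docstring of `Motives.sdim`). [cite: Hartshorne1977, I Ex. 1.10] -/
theorem sdim_eq_topologicalKrullDim_of_isClosed {Y : Set X} (hY : IsClosed Y) :
    Literature.AlgebraicGeometry.Motives.sdim Y = topologicalKrullDim Y :=
  le_antisymm (sdim_le_topologicalKrullDim_subtype Y) (topologicalKrullDim_subtype_le_sdim hY)

end Subspace

/-! ### Fibres of a morphism smooth of relative dimension `n` -/

section Fibre

open _root_.AlgebraicGeometry CategoryTheory

variable {X Y : Scheme.{u}} (f : X ⟶ Y) (n : ℕ)

/-- **The fibres of a morphism smooth of relative dimension `n` have dimension `≤ n`.** The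
scheme-theoretic fibre `f.fiber y = X ×_Y Spec κ(y)` is smooth of relative dimension `n` over the
field `κ(y)` (base change, Mathlib `smoothOfRelativeDimension_isStableUnderBaseChange`), hence of
dimension `≤ dim κ(y) + n = n` (`Dimension.topologicalKrullDim_le_of_smoothOfRelativeDimension`;
Hartshorne III.10, Görtz–Wedhorn I Lemma 6.26 for the field case). [cite: GortzWedhorn2020, Lemma 6.26] -/
theorem topologicalKrullDim_fiber_le_of_smoothOfRelativeDimension [SmoothOfRelativeDimension n f]
    (y : Y) : topologicalKrullDim (f.fiber y) ≤ n := by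
  haveI := smoothOfRelativeDimension_isStableUnderBaseChange n
  haveI : SmoothOfRelativeDimension n (f.fiberToSpecResidueField y) :=
    MorphismProperty.pullback_snd _ _ inferInstance
  haveI : IsNoetherianRing (Y.residueField y) := inferInstance
  have h := topologicalKrullDim_le_of_smoothOfRelativeDimension (f.fiberToSpecResidueField y) n
  have h0 : ringKrullDim (Y.residueField y) = 0 := ringKrullDim_eq_zero_of_field _
  rwa [h0, zero_add] at h

/-- The subspace `f ⁻¹ {y} ⊆ X` has dimension `≤ n` for `f` smooth of relative dimension `n`
(it is homeomorphic to the scheme-theoretic fibre, Mathlib `Scheme.Hom.fiberHomeo`).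
[cite: GortzWedhorn2020, Lemma 6.26] -/
theorem topologicalKrullDim_preimage_singleton_le [SmoothOfRelativeDimension n f] (y : Y) :
    topologicalKrullDim (f ⁻¹' {y} : Set X) ≤ n := by
  rw [← IsHomeomorph.topologicalKrullDim_eq _ (f.fiberHomeo y).isHomeomorph]
  exact topologicalKrullDim_fiber_le_of_smoothOfRelativeDimension f n y

/-- **`sdim (f ⁻¹ {y}) ≤ n`** for `f` smooth of relative dimension `n`: the form consumed by
Grothendieck vanishing with supports (`GrothendieckVanishingProof.vanishingOn`) for sheaves supported
on a fibre. [cite: GortzWedhorn2020, Lemma 6.26] -/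
theorem sdim_preimage_singleton_le [SmoothOfRelativeDimension n f] (y : Y) :
    Literature.AlgebraicGeometry.Motives.sdim (f ⁻¹' {y} : Set X) ≤ n :=
  (sdim_le_topologicalKrullDim_subtype _).trans (topologicalKrullDim_preimage_singleton_le f n y)

/-! #### Equality for non-empty fibres -/

/-- **Non-empty fibres of a morphism smooth of relative dimension `n` have dimension exactly `n`**
(Hartshorne III.10: the fibres of a smooth morphism of relative dimension `n` are "equidimensional of
dimension `n`"; the field case `Motives.topologicalKrullDim_eq_of_smoothOfRelativeDimension`, i.e.
Görtz–Wedhorn I Lemma 6.26 with Lemma 5.7 (4), applied to `f.fiber y → Spec κ(y)`).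
[cite: GortzWedhorn2020, Lemma 6.26 and Lemma 5.7 (4)] -/
theorem topologicalKrullDim_fiber_eq_of_smoothOfRelativeDimension [SmoothOfRelativeDimension n f]
    (y : Y) [Nonempty (f.fiber y)] : topologicalKrullDim (f.fiber y) = n := by
  haveI := smoothOfRelativeDimension_isStableUnderBaseChange n
  haveI : SmoothOfRelativeDimension n (f.fiberToSpecResidueField y) :=
    MorphismProperty.pullback_snd _ _ inferInstance
  exact Literature.AlgebraicGeometry.Motives.topologicalKrullDim_eq_of_smoothOfRelativeDimension
    (K := Y.residueField y) (f.fiberToSpecResidueField y) n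

/-- The scheme-theoretic fibre over a point of the image is non-empty. [folklore] -/
theorem nonempty_fiber_of_mem_range {y : Y} (hy : y ∈ Set.range f) : Nonempty (f.fiber y) := by
  obtain ⟨x, rfl⟩ := hy
  exact ⟨f.asFiber x⟩

/-- For `y` in the image of a morphism smooth of relative dimension `n`, the subspace `f ⁻¹ {y}`
has dimension exactly `n`. [cite: GortzWedhorn2020, Lemma 6.26 and Lemma 5.7 (4)] -/
theorem topologicalKrullDim_preimage_singleton_eq [SmoothOfRelativeDimension n f] {y : Y}
    (hy : y ∈ Set.range f) : topologicalKrullDim (f ⁻¹' {y} : Set X) = n := by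
  haveI := nonempty_fiber_of_mem_range f hy
  rw [← IsHomeomorph.topologicalKrullDim_eq _ (f.fiberHomeo y).isHomeomorph]
  exact topologicalKrullDim_fiber_eq_of_smoothOfRelativeDimension f n y

/-- For a CLOSED point `y` in the image of a morphism smooth of relative dimension `n`,
`sdim (f ⁻¹ {y}) = n` (the fibre is a closed subset, so `sdim` is its Krull dimension,
`sdim_eq_topologicalKrullDim_of_isClosed`). [cite: GortzWedhorn2020, Lemma 6.26 and Lemma 5.7 (4)] -/
theorem sdim_preimage_singleton_eq [SmoothOfRelativeDimension n f] {y : Y}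
    (hy : y ∈ Set.range f) (hyc : IsClosed ({y} : Set Y)) :
    Literature.AlgebraicGeometry.Motives.sdim (f ⁻¹' {y} : Set X) = n := by
  rw [sdim_eq_topologicalKrullDim_of_isClosed (hyc.preimage f.continuous),
    topologicalKrullDim_preimage_singleton_eq f n hy]

end Fibre

end Literature.AlgebraicGeometry.Dimension
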